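import Mathlib
import Literature.AlgebraicGeometry.Resolution.CobordantGame
import Summits.ResolutionOfSingularities.ResolutionOfSingularities.Theorems.WeightedInvariantLocalWeightedDropGradedSliceWildFrobRoot
import Summits.ResolutionOfSingularities.ResolutionOfSingularities.Theorems.WeightedInvariantLocalWeightedDropGradedSliceWildProbes
import Summits.ResolutionOfSingularities.ResolutionOfSingularities.Theorems.WeightedInvariantLocalWeightedDropGradedSliceWildFrobenius

/-!
# `WeightedInvariant.LocalWeightedDrop`: the wild slice at rank `0`, part 2 — THE CONJUGATE MOVE `Θ` (commutation lemma,
# algebraic half)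

Route `ResolutionOfSingularities/WeightedInvariant`, crux `LocalWeightedDrop` (stmt-ResolutionOfSingularities-8899).
[OURS · L1 W4.3] — res-type-099 (gen 13), res-L1-w43-plan-1 DEALS gen 10 #4 (2) / res-type-060 NAMING 10:55:26Z «099 TAKE (a)»:
(S3) `gradedWonBy_zero_of_slice_wild`, the RANK-`0` FLOOR of the repaired (minimal-valuation) wild slice clause of the
graded-slice line (ideator res-L1-w43-idea-1; res-type-060: tame half p515424, Frobenius-cover form + reduction to descent p525479,
memo HOME/L/res-type-060-w43/WILD-SLICE-CLAUSE.md §3 «the first graded move always transfers»).  Part 1 = `…GradedSliceWildFrobRoot`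
(root extraction `frobRoot`, diagonal scalings `scaleFam`); part 3 = `…GradedSliceWildOrbitSubst`; part 4 = `…GradedSliceWildRankZero`.
Nothing here is a statement of the manuscript under review on ladder RESOLUTION; not a verdict on card A.  AI proof, weaker than
expert review.

THE COMMUTATION LEMMA, algebraic half.  Let `θ` be a coordinate change of the slice variables `(s, y')` which is graded for the
slice lattice; at a wild frozen coordinate `y_v` (last) of minimal valuation every graded monomial `x^d` of `θ_i` satisfies
`ρ·(d − e_i) ≡ 0 (mod q)` for the orbit exponents `ρ = (1, resExp w q ·)` of res-type-060's scaling `Tw_q` (part 4,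
`weight_functional_modEq_zero`).  Then with `τ = ρ + q` and `u = (1+y_v)^{-1}` the COVER FAMILY `Ψ_i = u^{ρ_i}·θ_i((1+y_v)^τ x)
= Σ_d θ_{i,d} (1+y_v)^{τ·d − ρ_i} x^d` has all `y_v`-exponents `≡ 0 mod q` (`coeff_coverFam_ne_zero`), so the CONJUGATE MOVE
`Θ := (frobRoot_q Ψ_i)_i ⊔ (y_v ↦ y_v)` is an honest family on `k[[s, y', y_v]]` with `Θ_i(…, y_v^q) = Ψ_i`
(`subst_frobFamily_conjMove_castSucc`): zero constants, linear part = that of `θ` bordered by `1` (`det_linMat_conjMove`), and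
GRADED for the propagated lattice (`conjMove_graded`).

* §4 products with series pure in `y_v` (`coeff_pureLast_mul`, `coeff_pureLast_mul_subst_scaleFam`).
* §5 `coverFam`, `conjMove` and their coefficient / determinant / gradedness lemmas.
-/

set_option linter.dupNamespace false -- mandated namespace of this single-conjunct summit
set_option autoImplicit false

namespace Summit.ResolutionOfSingularities.ResolutionOfSingularities.Theorems

namespace GradedGame

open MvPowerSeries
open Literature.AlgebraicGeometry.Resolution

variable {k : Type} [Field k]

/-! ## §4 Products with series in the frozen coordinate alone -/

section PureLast

variable {m : ℕ}

/-- Powers `(1 + y_v)^N` are PURE in `y_v` (all exponents on the `y_v`-axis). [OURS · L1 W4.3] -/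
theorem isPureLast_one_add_X_pow (N : ℕ) :
    ∀ A, coeff A (((1 : MvPowerSeries (Fin (m + 1)) k) + X (Fin.last m)) ^ N) ≠ 0 → ∃ a : ℕ, A = Finsupp.single (Fin.last m) a :=
  fun A hA => exists_eq_single_of_coeff_one_add_X_pow (Fin.last m) N A hA

/-- Products of pure series are pure. [OURS · L1 W4.3] -/
theorem isPureLast_mul {W W' : MvPowerSeries (Fin (m + 1)) k}
    (hW : ∀ A, coeff A W ≠ 0 → ∃ a : ℕ, A = Finsupp.single (Fin.last m) a)
    (hW' : ∀ A, coeff A W' ≠ 0 → ∃ a : ℕ, A = Finsupp.single (Fin.last m) a) :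
    ∀ A, coeff A (W * W') ≠ 0 → ∃ a : ℕ, A = Finsupp.single (Fin.last m) a := by
  classical
  intro A hA
  rw [coeff_mul] at hA
  obtain ⟨p, hp, hne⟩ := Finset.exists_ne_zero_of_sum_ne_zero hA
  have hpA : p.1 + p.2 = A := by simpa using hp
  obtain ⟨a, ha⟩ := hW p.1 (left_ne_zero_of_mul hne)
  obtain ⟨b, hb⟩ := hW' p.2 (right_ne_zero_of_mul hne)
  exact ⟨a + b, by rw [← hpA, ha, hb, Finsupp.single_add]⟩

/-- Powers of pure series are pure. [OURS · L1 W4.3] -/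
theorem isPureLast_pow {W : MvPowerSeries (Fin (m + 1)) k} (hW : ∀ A, coeff A W ≠ 0 → ∃ a : ℕ, A = Finsupp.single (Fin.last m) a)
    (r : ℕ) : ∀ A, coeff A (W ^ r) ≠ 0 → ∃ a : ℕ, A = Finsupp.single (Fin.last m) a := by
  induction r with
  | zero =>
    intro A hA
    rw [pow_zero, coeff_one] at hA
    refine ⟨0, ?_⟩
    by_contra h
    exact hA (if_neg (by rintro rfl; simp at h))
  | succ r ih => rw [pow_succ]; exact isPureLast_mul ih hW

/-- **PRODUCT WITH A PURE SERIES = CONVOLUTION IN THE `y_v`-SLOT**: for `W` pure in `y_v`, the coefficient of `x^d·y_v^t` in `W·F`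
is `Σ_{a ≤ t} W_a · F_{x^d y_v^{t−a}}`. [OURS · L1 W4.3] -/
theorem coeff_pureLast_mul {W : MvPowerSeries (Fin (m + 1)) k} (hW : ∀ A, coeff A W ≠ 0 → ∃ a : ℕ, A = Finsupp.single (Fin.last m) a)
    (F : MvPowerSeries (Fin (m + 1)) k) (d : Fin m →₀ ℕ) (t : ℕ) :
    coeff (linExp (cylExp m) d + Finsupp.single (Fin.last m) t) (W * F) =
      ∑ a ∈ Finset.range (t + 1), coeff (Finsupp.single (Fin.last m) a) W *
        coeff (linExp (cylExp m) d + Finsupp.single (Fin.last m) (t - a)) F := by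
  classical
  set E := linExp (cylExp m) d + Finsupp.single (Fin.last m) t with hE
  set ι : ℕ → (Fin (m + 1) →₀ ℕ) × (Fin (m + 1) →₀ ℕ) :=
    fun a => (Finsupp.single (Fin.last m) a, linExp (cylExp m) d + Finsupp.single (Fin.last m) (t - a)) with hι
  have hιinj : Function.Injective ι := by
    intro a b h
    have := congrArg (fun p => p.1 (Fin.last m)) h
    simpa [hι] using this
  have himg : ∀ a ∈ Finset.range (t + 1), ι a ∈ Finset.HasAntidiagonal.antidiagonal E := by
    intro a ha
    rw [Finset.mem_range] at ha
    rw [Finset.HasAntidiagonal.mem_antidiagonal, hι, hE]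
    simp only
    rw [add_left_comm, ← Finsupp.single_add]
    congr 2
    omega
  have hsum : (∑ a ∈ Finset.range (t + 1), coeff (Finsupp.single (Fin.last m) a) W *
      coeff (linExp (cylExp m) d + Finsupp.single (Fin.last m) (t - a)) F) =
      ∑ p ∈ (Finset.range (t + 1)).image ι, coeff p.1 W * coeff p.2 F := by
    rw [Finset.sum_image (fun a _ b _ h => hιinj h)]
  rw [coeff_mul, hsum]
  symm
  apply Finset.sum_subset
  · intro p hp
    rw [Finset.mem_image] at hp
    obtain ⟨a, ha, rfl⟩ := hp
    exact himg a ha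
  · intro p hp hnot
    by_cases hz : coeff p.1 W = 0
    · rw [hz, zero_mul]
    · exfalso
      apply hnot
      obtain ⟨a, ha⟩ := hW p.1 hz
      rw [Finset.HasAntidiagonal.mem_antidiagonal] at hp
      rw [Finset.mem_image]
      have hat : a ≤ t := by
        have := DFunLike.congr_fun hp (Fin.last m)
        rw [Finsupp.add_apply, ha, Finsupp.single_eq_same, hE, Finsupp.add_apply, linExp_cylExp_last,
          Finsupp.single_eq_same] at this
        omega
      refine ⟨a, Finset.mem_range.mpr (by omega), ?_⟩
      rw [hι]
      ext1
      · exact ha.symm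
      · simp only
        have h2 : p.2 = E - p.1 := by rw [← hp]; simp
        rw [h2, ha, hE]
        ext j
        refine Fin.lastCases ?_ (fun l => ?_) j
        · simp [linExp_cylExp_last]
        · simp [linExp_cylExp_castSucc, (Fin.castSucc_lt_last l).ne]

/-- **COEFFICIENTS OF `W · f(scaleFam τ)` FOR `W` PURE**: `[x^d y_v^t] (W · f((1+y_v)^τ x)) = f_d · [y_v^t] (W · (1+y_v)^{τ·d})`.
[OURS · L1 W4.3] -/
theorem coeff_pureLast_mul_subst_scaleFam (τ : Fin m → ℕ) {W : MvPowerSeries (Fin (m + 1)) k}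
    (hW : ∀ A, coeff A W ≠ 0 → ∃ a : ℕ, A = Finsupp.single (Fin.last m) a) (f : MvPowerSeries (Fin m) k) (d : Fin m →₀ ℕ) (t : ℕ) :
    coeff (linExp (cylExp m) d + Finsupp.single (Fin.last m) t) (W * subst (scaleFam (k := k) τ) f) =
      coeff d f * coeff (Finsupp.single (Fin.last m) t) (W * ((1 + X (Fin.last m)) ^ (tauDeg τ d) : MvPowerSeries (Fin (m + 1)) k)) := by
  rw [coeff_pureLast_mul hW, Finset.sum_congr rfl (fun a _ => by rw [coeff_subst_scaleFam])]
  have h0 : (Finsupp.single (Fin.last m) t : Fin (m + 1) →₀ ℕ) = linExp (cylExp m) 0 + Finsupp.single (Fin.last m) t := by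
    unfold linExp; simp
  rw [h0, coeff_pureLast_mul hW, Finset.mul_sum]
  refine Finset.sum_congr rfl fun a _ => ?_
  have h0' : linExp (cylExp m) (0 : Fin m →₀ ℕ) + Finsupp.single (Fin.last m) (t - a) = Finsupp.single (Fin.last m) (t - a) := by
    unfold linExp; simp
  rw [h0']
  ring

end PureLast

/-! ## §5 The conjugate move `Θ` (slice variables `Fin (n+1)`, successor variables `Fin (n+1+1)`, frozen `y_v` = last) -/

section ConjMove

variable {n : ℕ} (q : ℕ) (ρ τ : Fin (n + 1) → ℕ) (u : MvPowerSeries (Fin (n + 1 + 1)) k)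
  (θ : Fin (n + 1) → MvPowerSeries (Fin (n + 1)) k)

/-- The COVER FAMILY `Ψ_i = u^{ρ_i} · θ_i((1+y_v)^{τ} x)` (`u` = the inverse of `1 + y_v`): the conjugate of the slice move by the
formal `q`-th root of the orbit scaling, read on the Frobenius cover. [OURS · L1 W4.3] -/
noncomputable def coverFam (i : Fin (n + 1)) : MvPowerSeries (Fin (n + 1 + 1)) k :=
  u ^ (ρ i) * subst (scaleFam (k := k) τ) (θ i)

/-- **THE CONJUGATE MOVE** `Θ = (frobRoot_q Ψ_i)_i ⊔ (y_v ↦ y_v)` on `k[[s, y', y_v]]`. [OURS · L1 W4.3] -/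
noncomputable def conjMove : Fin (n + 1 + 1) → MvPowerSeries (Fin (n + 1 + 1)) k :=
  Fin.snoc (fun i => frobRoot q (coverFam ρ τ u θ i)) (X (Fin.last (n + 1)))

variable {q ρ τ u θ}

/-- Components of the conjugate move. [OURS · L1 W4.3] -/
theorem conjMove_castSucc (i : Fin (n + 1)) : conjMove q ρ τ u θ (Fin.castSucc i) = frobRoot q (coverFam ρ τ u θ i) := by
  simp [conjMove]

/-- The conjugate move fixes the frozen coordinate. [OURS · L1 W4.3] -/
theorem conjMove_last : conjMove q ρ τ u θ (Fin.last (n + 1)) = X (Fin.last (n + 1)) := by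
  simp [conjMove]

/-- The cover family on monomials: `[x^d y_v^t] Ψ_i = θ_{i,d} · [y_v^t] (u^{ρ_i}(1+y_v)^{τ·d})`. [OURS · L1 W4.3] -/
theorem coeff_coverFam (hu : ∀ A, coeff A u ≠ 0 → ∃ a : ℕ, A = Finsupp.single (Fin.last (n + 1)) a) (i : Fin (n + 1))
    (d : Fin (n + 1) →₀ ℕ) (t : ℕ) :
    coeff (linExp (cylExp (n + 1)) d + Finsupp.single (Fin.last (n + 1)) t) (coverFam ρ τ u θ i) =
      coeff d (θ i) * coeff (Finsupp.single (Fin.last (n + 1)) t)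
        (u ^ (ρ i) * ((1 + X (Fin.last (n + 1))) ^ (tauDeg τ d) : MvPowerSeries (Fin (n + 1 + 1)) k)) :=
  coeff_pureLast_mul_subst_scaleFam τ (isPureLast_pow hu (ρ i)) (θ i) d t

/-- `u^r · (1+y_v)^N = (1+y_v)^{N−r}` when `u(1+y_v) = 1` and `r ≤ N`. [OURS · L1 W4.3] -/
theorem inv_pow_mul_one_add_X_pow (hu1 : u * (1 + X (Fin.last (n + 1))) = 1) {r N : ℕ} (h : r ≤ N) :
    u ^ r * ((1 + X (Fin.last (n + 1))) ^ N : MvPowerSeries (Fin (n + 1 + 1)) k) = (1 + X (Fin.last (n + 1))) ^ (N - r) := by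
  obtain ⟨s, rfl⟩ := Nat.exists_eq_add_of_le h
  rw [Nat.add_sub_cancel_left, pow_add, ← mul_assoc, ← mul_pow, hu1, one_pow, one_mul]

/-- **NON-ZERO COEFFICIENTS OF THE COVER FAMILY**: if every monomial `x^d` of `θ_i` has `ρ_i ≤ τ·d` and `q ∣ τ·d − ρ_i`, then
(in a ring with `(1+y_v)^q = 1 + y_v^q`) at a non-zero coefficient `x^d·y_v^t` of `Ψ_i` we have `θ_{i,d} ≠ 0` and `q ∣ t`.
[OURS · L1 W4.3] -/
theorem coeff_coverFam_ne_zero (hq : 0 < q)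
    (hfrob : ((1 : MvPowerSeries (Fin (n + 1 + 1)) k) + X (Fin.last (n + 1))) ^ q = 1 + X (Fin.last (n + 1)) ^ q)
    (hu : ∀ A, coeff A u ≠ 0 → ∃ a : ℕ, A = Finsupp.single (Fin.last (n + 1)) a) (hu1 : u * (1 + X (Fin.last (n + 1))) = 1)
    (i : Fin (n + 1)) (hdiv : ∀ d, coeff d (θ i) ≠ 0 → ρ i ≤ tauDeg τ d ∧ q ∣ tauDeg τ d - ρ i)
    (E : Fin (n + 1 + 1) →₀ ℕ) (hE : coeff E (coverFam ρ τ u θ i) ≠ 0) :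
    coeff (Finsupp.equivFunOnFinite.symm fun j => E (Fin.castSucc j) : Fin (n + 1) →₀ ℕ) (θ i) ≠ 0 ∧ q ∣ E (Fin.last (n + 1)) := by
  set d : Fin (n + 1) →₀ ℕ := Finsupp.equivFunOnFinite.symm fun j => E (Fin.castSucc j) with hd
  rw [eq_linExp_cylExp_add_single E, coeff_coverFam hu] at hE
  have hθ : coeff d (θ i) ≠ 0 := left_ne_zero_of_mul hE
  have hc := right_ne_zero_of_mul hE
  obtain ⟨hle, M, hM⟩ := hdiv d hθ
  rw [inv_pow_mul_one_add_X_pow hu1 hle, hM] at hc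
  refine ⟨hθ, ?_⟩
  by_contra hndvd
  exact hc (coeff_one_add_X_pow_mul_eq_zero n q hq hfrob M _ (by rwa [Finsupp.single_eq_same]))

/-- **THE CONJUGATE MOVE READ ON THE COVER**: `Θ_i(…, y_v^q) = Ψ_i`. [OURS · L1 W4.3] -/
theorem subst_frobFamily_conjMove_castSucc (hq : 0 < q)
    (hfrob : ((1 : MvPowerSeries (Fin (n + 1 + 1)) k) + X (Fin.last (n + 1))) ^ q = 1 + X (Fin.last (n + 1)) ^ q)
    (hu : ∀ A, coeff A u ≠ 0 → ∃ a : ℕ, A = Finsupp.single (Fin.last (n + 1)) a) (hu1 : u * (1 + X (Fin.last (n + 1))) = 1)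
    (hdiv : ∀ i d, coeff d (θ i) ≠ 0 → ρ i ≤ tauDeg τ d ∧ q ∣ tauDeg τ d - ρ i) (i : Fin (n + 1)) :
    subst (frobFamily (k := k) n q) (conjMove q ρ τ u θ (Fin.castSucc i)) = coverFam ρ τ u θ i := by
  rw [conjMove_castSucc]
  exact subst_frobFamily_frobRoot n q hq _ fun E hE => (coeff_coverFam_ne_zero hq hfrob hu hu1 i (hdiv i) E hE).2

/-- … and `Θ_v(…, y_v^q) = y_v^q`. [OURS · L1 W4.3] -/
theorem subst_frobFamily_conjMove_last (hq : 0 < q) :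
    subst (frobFamily (k := k) n q) (conjMove q ρ τ u θ (Fin.last (n + 1))) = X (Fin.last (n + 1)) ^ q := by
  rw [conjMove_last, subst_X (hasSubst_frobFamily (n := n) q hq)]
  simp [frobFamily]

/-- The conjugate move has zero constant terms (`θ` does). [OURS · L1 W4.3] -/
theorem constantCoeff_conjMove (hθ0 : ∀ i, constantCoeff (θ i) = 0) (j : Fin (n + 1 + 1)) :
    constantCoeff (conjMove q ρ τ u θ j) = 0 := by
  refine Fin.lastCases ?_ (fun i => ?_) j
  · rw [conjMove_last]; exact constantCoeff_X _
  · rw [conjMove_castSucc, constantCoeff_frobRoot, coverFam, map_mul,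
      constantCoeff_subst_eq_zero (hasSubst_scaleFam τ) (constantCoeff_scaleFam τ) (hθ0 i), mul_zero]

/-- LINEAR PART OF THE CONJUGATE MOVE, slice block: `[x_l] Θ_i = [x_l] θ_i`. [OURS · L1 W4.3] -/
theorem coeff_single_castSucc_conjMove_castSucc (hu : ∀ A, coeff A u ≠ 0 → ∃ a : ℕ, A = Finsupp.single (Fin.last (n + 1)) a)
    (hu0 : constantCoeff u = 1) (i l : Fin (n + 1)) :
    coeff (Finsupp.single (Fin.castSucc l) 1) (conjMove q ρ τ u θ (Fin.castSucc i)) = coeff (Finsupp.single l 1) (θ i) := by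
  rw [conjMove_castSucc, coeff_single_castSucc_frobRoot]
  have h : (Finsupp.single (Fin.castSucc l) 1 : Fin (n + 1 + 1) →₀ ℕ) =
      linExp (cylExp (n + 1)) (Finsupp.single l 1) + Finsupp.single (Fin.last (n + 1)) 0 := by
    rw [linExp_cylExp_single, Finsupp.single_zero, add_zero]
  rw [h, coeff_coverFam hu, Finsupp.single_zero, coeff_zero_eq_constantCoeff_apply, map_mul, map_pow, hu0, one_pow, one_mul,
    constantCoeff_one_add_X_pow, mul_one]

/-- LINEAR PART OF THE CONJUGATE MOVE, frozen column: `[y_v] Θ_i = 0` (it is `[y_v^q] Ψ_i = θ_i(0)·… = 0`). [OURS · L1 W4.3] -/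
theorem coeff_single_last_conjMove_castSucc (hu : ∀ A, coeff A u ≠ 0 → ∃ a : ℕ, A = Finsupp.single (Fin.last (n + 1)) a)
    (hθ0 : ∀ i, constantCoeff (θ i) = 0) (i : Fin (n + 1)) :
    coeff (Finsupp.single (Fin.last (n + 1)) 1) (conjMove q ρ τ u θ (Fin.castSucc i)) = 0 := by
  rw [conjMove_castSucc, coeff_single_last_frobRoot]
  have h : (Finsupp.single (Fin.last (n + 1)) q : Fin (n + 1 + 1) →₀ ℕ) =
      linExp (cylExp (n + 1)) 0 + Finsupp.single (Fin.last (n + 1)) q := by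
    unfold linExp; simp
  rw [h, coeff_coverFam hu, coeff_zero_eq_constantCoeff_apply, hθ0 i, zero_mul]

/-- **THE LINEAR PART OF `Θ` IS THAT OF `θ` BORDERED BY `1`**: `det (linMat Θ) = det (linMat θ)` (Laplace along the frozen row).
[OURS · L1 W4.3] -/
theorem det_linMat_conjMove (hu : ∀ A, coeff A u ≠ 0 → ∃ a : ℕ, A = Finsupp.single (Fin.last (n + 1)) a)
    (hu0 : constantCoeff u = 1) :
    (Matrix.of fun a b => coeff (Finsupp.single b 1) (conjMove q ρ τ u θ a)).det =
      (Matrix.of fun a b => coeff (Finsupp.single b 1) (θ a)).det := by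
  classical
  set M : Matrix (Fin (n + 1)) (Fin (n + 1)) k := Matrix.of fun a b => coeff (Finsupp.single b 1) (θ a) with hM
  set M' : Matrix (Fin (n + 1 + 1)) (Fin (n + 1 + 1)) k :=
    Matrix.of fun a b => coeff (Finsupp.single b 1) (conjMove q ρ τ u θ a) with hM'
  have hlast : ∀ b, M' (Fin.last (n + 1)) b = if b = Fin.last (n + 1) then 1 else 0 := by
    intro b
    simp only [hM', Matrix.of_apply, conjMove_last, coeff_X]
    by_cases hb : b = Fin.last (n + 1)
    · subst hb; simp
    · rw [if_neg hb, if_neg]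
      intro h'
      exact hb ((Finsupp.single_left_inj one_ne_zero).mp h')
  have hsub : M'.submatrix (Fin.last (n + 1)).succAbove (Fin.last (n + 1)).succAbove = M := by
    ext a b
    simp only [Matrix.submatrix_apply, Fin.succAbove_last, hM', hM, Matrix.of_apply]
    exact coeff_single_castSucc_conjMove_castSucc hu hu0 a b
  rw [Matrix.det_succ_row M' (Fin.last (n + 1)), Finset.sum_eq_single (Fin.last (n + 1))]
  · rw [hlast, if_pos rfl, hsub, mul_one, Even.neg_one_pow ⟨(Fin.last (n + 1) : ℕ), rfl⟩, one_mul]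
  · intro b _ hb
    rw [hlast, if_neg hb, mul_zero, zero_mul]
  · intro h; exact absurd (Finset.mem_univ _) h

/-- **THE CONJUGATE MOVE IS GRADED** for every lattice `L'` containing `e_v` and the cylinder of the slice lattice `Lh`, as soon as
`θ` is `Lh`-graded. [OURS · L1 W4.3] -/
theorem conjMove_graded (hq : 0 < q)
    (hfrob : ((1 : MvPowerSeries (Fin (n + 1 + 1)) k) + X (Fin.last (n + 1))) ^ q = 1 + X (Fin.last (n + 1)) ^ q)
    (hu : ∀ A, coeff A u ≠ 0 → ∃ a : ℕ, A = Finsupp.single (Fin.last (n + 1)) a) (hu1 : u * (1 + X (Fin.last (n + 1))) = 1)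
    (hdiv : ∀ i d, coeff d (θ i) ≠ 0 → ρ i ≤ tauDeg τ d ∧ q ∣ tauDeg τ d - ρ i)
    (Lh : AddSubgroup (Fin (n + 1) → ℤ)) (L' : AddSubgroup (Fin (n + 1 + 1) → ℤ)) (hcyl : cylLattice Lh ≤ L')
    (hlast : (Pi.single (Fin.last (n + 1)) 1 : Fin (n + 1 + 1) → ℤ) ∈ L')
    (hgr : ∀ i d, coeff d (θ i) ≠ 0 → expVec d - Pi.single i 1 ∈ Lh) :
    ∀ j (E : Fin (n + 1 + 1) →₀ ℕ), coeff E (conjMove q ρ τ u θ j) ≠ 0 → expVec E - Pi.single j 1 ∈ L' := by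
  intro j
  refine Fin.lastCases ?_ (fun i => ?_) j
  · intro E hE
    rw [conjMove_last, coeff_X] at hE
    have hEj : E = Finsupp.single (Fin.last (n + 1)) 1 := by
      by_contra hne
      exact hE (if_neg hne)
    subst hEj
    rw [expVec_single, Nat.cast_one, sub_self]
    exact L'.zero_mem
  · intro E hE
    rw [conjMove_castSucc, coeff_frobRoot] at hE
    obtain ⟨hθ, -⟩ := coeff_coverFam_ne_zero hq hfrob hu hu1 i (hdiv i) _ hE
    set d : Fin (n + 1) →₀ ℕ := Finsupp.equivFunOnFinite.symm fun j => linExp (frobExp (n + 1) q) E (Fin.castSucc j) with hd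
    have hmem := hgr i d hθ
    -- decompose `expVec E − e_{castSucc i}` as (cylinder of `expVec d − e_i`) + (E_v) • e_v
    have hdec : (expVec E - Pi.single (Fin.castSucc i) 1 : Fin (n + 1 + 1) → ℤ) =
        (fun x => (expVec E - Pi.single (Fin.castSucc i) 1 : Fin (n + 1 + 1) → ℤ) x -
          (E (Fin.last (n + 1)) : ℤ) * (Pi.single (Fin.last (n + 1)) 1 : Fin (n + 1 + 1) → ℤ) x) +
        (E (Fin.last (n + 1)) : ℤ) • (Pi.single (Fin.last (n + 1)) 1 : Fin (n + 1 + 1) → ℤ) := by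
      funext x; simp
    rw [hdec]
    refine L'.add_mem (hcyl ?_) (L'.zsmul_mem hlast _)
    rw [mem_cylLattice_iff]
    have hfun : (fun j => ((expVec E - Pi.single (Fin.castSucc i) 1 : Fin (n + 1 + 1) → ℤ) (Fin.castSucc j) -
        (E (Fin.last (n + 1)) : ℤ) * (Pi.single (Fin.last (n + 1)) 1 : Fin (n + 1 + 1) → ℤ) (Fin.castSucc j))) =
        expVec d - Pi.single i 1 := by
      funext j
      simp only [Pi.sub_apply, expVec, hd, Finsupp.coe_equivFunOnFinite_symm, linExp_frobExp_castSucc,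
        Pi.single_eq_of_ne (Fin.castSucc_lt_last j).ne, mul_zero, sub_zero]
      by_cases hj : j = i
      · subst hj; simp
      · rw [Pi.single_eq_of_ne hj, Pi.single_eq_of_ne (fun h => hj (Fin.castSucc_injective _ h))]
    rw [hfun]
    exact hmem

end ConjMove

end GradedGame

end Summit.ResolutionOfSingularities.ResolutionOfSingularities.Theorems
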